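import Summits.Schanuel.Schanuel.Theorems.ZilberEacAnalyticGerms
import Mathlib.Algebra.Polynomial.FieldDivision
import Mathlib.Analysis.Calculus.Deriv.Mul
import Mathlib.Analysis.Calculus.Deriv.Pow
import Mathlib.Analysis.Calculus.Deriv.Add
import HarnessLib

/-!
# The equimodular class, II: a primitive of the logarithmic derivative of a non-constant
# rational function is transcendental over `ℂ(z)`

HONEST FRAMING.  Cell `pub-schanuel` (Zilber's Exponential-Algebraic Closedness, case ladder;
host summit Schanuel), seat 2, gen 22.  Classical differential algebra, made concrete:
**`not_algebraic_of_hasDerivAt_logDeriv`** — if `L` is analytic near `z₀` with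
`L' = (A B' - A' B)/(A B)` there (`A, B ∈ ℂ[z]` nonzero, some point is a root of exactly one of
them, `(A B)(z₀) ≠ 0`), then NO nonzero `P ∈ ℂ[s][t]` has `P(z, L z) = 0` near `z₀`.  Proof: a
`P` of minimal `t`-degree `M ≥ 1`; differentiating `P(z, L z) = 0` and clearing `A B` gives a second
relation `P̃` with the same top coefficient up to the factor `A B p_M' / p_M`, so
`p_M P̃ - A B p_M' P` has `t`-degree `< M`, hence vanishes; its `t^{M-1}`-coefficient is
`A B (p_M p_{M-1}' - p_M' p_{M-1}) + M (A B' - A' B) p_M²`, which is NONZERO by comparing orders of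
vanishing at a root of `A` that is not a root of `B` (`logDeriv_coeff_ne_zero`: the second term has
order exactly `n - 1 + 2 ord p_M`, the first has a different order or order `≥ n + 2 ord p_M`).  This is
the input "log of a non-constant rational function is not algebraic" of the transcendence mechanism
of file III.  [folklore]; nothing here is specific to Schanuel's conjecture (neither used nor implied).
-/

noncomputable section

open Filter Topology Polynomial

set_option linter.dupNamespace false

namespace Summit.Schanuel.Schanuel.Theorems

/-! ## Part A. Orders of vanishing: the key coefficient is nonzero -/

section Orders

variable {a : ℂ}

/-- `(X - a)·f' = v (X - a)^v f₁ + (X - a)^{v+1} f₁'` for `f = (X - a)^v f₁`. [folklore] -/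
theorem X_sub_C_mul_derivative_pow_mul (a : ℂ) (v : ℕ) (f₁ : ℂ[X]) :
    (X - C a) * derivative ((X - C a) ^ v * f₁) =
      (v : ℂ[X]) * ((X - C a) ^ v * f₁) + (X - C a) ^ (v + 1) * derivative f₁ := by
  rcases Nat.eq_zero_or_pos v with rfl | hv; · simp
  · rw [derivative_mul, derivative_pow, derivative_sub, derivative_X, derivative_C, sub_zero, mul_one]
    obtain ⟨k, rfl⟩ : ∃ k, v = k + 1 := ⟨v - 1, (Nat.sub_add_cancel hv).symm⟩
    simp only [Nat.add_sub_cancel, Nat.cast_add, Nat.cast_one, map_add, map_natCast, map_one]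
    ring

/-- The Wronskian identity: for `p = (X - a)^v P₁`, `q = (X - a)^u Q₁`,
`(X - a)(p q' - p' q) = (X - a)^{u+v} ((u - v) P₁ Q₁ + (X - a)(P₁ Q₁' - P₁' Q₁))`. [folklore] -/
theorem X_sub_C_mul_wronskian (a : ℂ) (u v : ℕ) (P₁ Q₁ : ℂ[X]) :
    (X - C a) * (((X - C a) ^ v * P₁) * derivative ((X - C a) ^ u * Q₁) -
        derivative ((X - C a) ^ v * P₁) * ((X - C a) ^ u * Q₁)) =
      (X - C a) ^ (u + v) * ((((u : ℂ[X])) - ((v : ℂ[X]))) * P₁ * Q₁ +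
        (X - C a) * (P₁ * derivative Q₁ - derivative P₁ * Q₁)) := by
  have h1 := X_sub_C_mul_derivative_pow_mul a u Q₁
  have h2 := X_sub_C_mul_derivative_pow_mul a v P₁
  have e : (X - C a) * (((X - C a) ^ v * P₁) * derivative ((X - C a) ^ u * Q₁) -
      derivative ((X - C a) ^ v * P₁) * ((X - C a) ^ u * Q₁)) =
      ((X - C a) ^ v * P₁) * ((X - C a) * derivative ((X - C a) ^ u * Q₁)) -
        ((X - C a) * derivative ((X - C a) ^ v * P₁)) * ((X - C a) ^ u * Q₁) := by ring
  rw [e, h1, h2]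
  ring

/-- Root multiplicity of `(X - a)^k f₁` with `(X - a) ∤ f₁` is `k`. [folklore] -/
theorem rootMultiplicity_pow_mul_of_not_dvd {k : ℕ} {f₁ : ℂ[X]} (hf₁ : ¬ (X - C a) ∣ f₁) :
    rootMultiplicity a ((X - C a) ^ k * f₁) = k := by
  have hf₁0 : f₁ ≠ 0 := fun h => hf₁ (h ▸ dvd_zero _)
  have hne : (X - C a) ^ k * f₁ ≠ 0 := mul_ne_zero (pow_ne_zero _ (X_sub_C_ne_zero a)) hf₁0
  rw [rootMultiplicity_mul hne, rootMultiplicity_X_sub_C_pow,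
    rootMultiplicity_eq_zero (fun h => hf₁ (dvd_iff_isRoot.2 h)), add_zero]

/-- Root multiplicity is insensitive to sign. [folklore] -/
theorem rootMultiplicity_neg_eq (f : ℂ[X]) : rootMultiplicity a (-f) = rootMultiplicity a f := by
  by_cases hf : f = 0
  · rw [hf, neg_zero]
  have hnf : -f ≠ 0 := neg_ne_zero.2 hf
  apply le_antisymm
  · rw [le_rootMultiplicity_iff hf]
    exact dvd_neg.1 (pow_rootMultiplicity_dvd (-f) a)
  · rw [le_rootMultiplicity_iff hnf]
    exact dvd_neg.2 (pow_rootMultiplicity_dvd f a)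

/-- If `ord_a f < ord_a g` for nonzero `f, g` then `f + g ≠ 0`. [folklore] -/
theorem add_ne_zero_of_rootMultiplicity_lt {f g : ℂ[X]} (hf : f ≠ 0) (hg : g ≠ 0)
    (hlt : rootMultiplicity a f < rootMultiplicity a g) : f + g ≠ 0 := by
  intro h
  have hfg : f = -g := eq_neg_of_add_eq_zero_left h
  have h1 : (X - C a) ^ (rootMultiplicity a f + 1) ∣ g :=
    (le_rootMultiplicity_iff hg).1 (Nat.succ_le_of_lt hlt)
  have h2 : (X - C a) ^ (rootMultiplicity a f + 1) ∣ f := by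
    have h3 := h1.neg_right
    rwa [← hfg] at h3
  exact (rootMultiplicity_le_iff hf a (rootMultiplicity a f)).1 le_rfl h2

/-- Two nonzero polynomials with different root multiplicities at `a` do not cancel. [folklore] -/
theorem add_ne_zero_of_rootMultiplicity_ne {f g : ℂ[X]} (hf : f ≠ 0) (hg : g ≠ 0)
    (hne : rootMultiplicity a f ≠ rootMultiplicity a g) : f + g ≠ 0 := by
  rcases lt_or_gt_of_ne hne with hlt | hlt
  · exact add_ne_zero_of_rootMultiplicity_lt hf hg hlt
  · rw [add_comm]; exact add_ne_zero_of_rootMultiplicity_lt hg hf hlt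

/-- If `(X - a)^{k+1} ∣ f` and `g ≠ 0` has root multiplicity `k`, then `f + g ≠ 0`. [folklore] -/
theorem add_ne_zero_of_dvd_of_rootMultiplicity_eq {f g : ℂ[X]} {k : ℕ} (hf : (X - C a) ^ (k + 1) ∣ f)
    (hg : g ≠ 0) (hk : rootMultiplicity a g = k) : f + g ≠ 0 := by
  intro h
  have hgf : g = -f := eq_neg_of_add_eq_zero_right h
  have h2 : (X - C a) ^ (k + 1) ∣ g := by rw [hgf]; exact hf.neg_right
  exact (rootMultiplicity_le_iff hg a k).1 hk.le h2

/-- **Orders at a root of `F` that is not a root of `G`.**  With `n = ord_a (F G) ≥ 1`: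
`F G' - F' G ≠ 0` and `ord_a (F G' - F' G) = n - 1`. [folklore] -/
theorem rootMultiplicity_logDeriv_num {F G : ℂ[X]} (hF : F ≠ 0) (hG : G ≠ 0) (hFa : F.IsRoot a)
    (hGa : ¬ G.IsRoot a) :
    1 ≤ rootMultiplicity a (F * G) ∧ F * derivative G - derivative F * G ≠ 0 ∧
      rootMultiplicity a (F * derivative G - derivative F * G) = rootMultiplicity a (F * G) - 1 := by
  set nF := rootMultiplicity a F with hnF
  have hnF1 : 1 ≤ nF := (rootMultiplicity_pos hF).2 hFa
  have hFG : F * G ≠ 0 := mul_ne_zero hF hG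
  have hn : rootMultiplicity a (F * G) = nF := by
    rw [rootMultiplicity_mul hFG, rootMultiplicity_eq_zero hGa, add_zero]
  -- `F' ≠ 0`
  have hF' : derivative F ≠ 0 := by
    intro h0
    have hdeg : F.natDegree = 0 := Polynomial.derivative_eq_zero.1 h0
    rw [Polynomial.eq_C_of_natDegree_eq_zero hdeg, IsRoot, eval_C] at hFa
    apply hF
    rw [Polynomial.eq_C_of_natDegree_eq_zero hdeg, hFa, map_zero]
  have hF'G : derivative F * G ≠ 0 := mul_ne_zero hF' hG
  have hrmF'G : rootMultiplicity a (derivative F * G) = nF - 1 := by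
    rw [rootMultiplicity_mul hF'G, derivative_rootMultiplicity_of_root hFa, rootMultiplicity_eq_zero hGa,
      add_zero]
  -- divisibility facts
  have hdvd1 : (X - C a) ^ nF ∣ F * derivative G :=
    (pow_rootMultiplicity_dvd F a).mul_right _
  have hndvd : ¬ (X - C a) ^ nF ∣ derivative F * G := by
    rw [← le_rootMultiplicity_iff hF'G, hrmF'G]; omega
  have hR₁ne : F * derivative G - derivative F * G ≠ 0 := by
    intro h0
    exact hndvd ((sub_eq_zero.1 h0).symm ▸ hdvd1)
  refine ⟨hn ▸ hnF1, hR₁ne, ?_⟩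
  rw [hn]
  apply le_antisymm
  · rw [rootMultiplicity_le_iff hR₁ne, Nat.sub_add_cancel hnF1]
    intro h
    apply hndvd
    have : derivative F * G = F * derivative G - (F * derivative G - derivative F * G) := by ring
    rw [this]
    exact dvd_sub hdvd1 h
  · rw [le_rootMultiplicity_iff hR₁ne]
    refine dvd_sub ((pow_dvd_pow _ (Nat.sub_le _ _)).trans hdvd1) ?_
    rw [← hrmF'G]
    exact pow_rootMultiplicity_dvd _ _

/-- **The key coefficient is nonzero.**  `A, B ≠ 0`, `a` a root of exactly one of them,
`p ≠ 0`, `M ≠ 0` ⟹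
`p (A B q' + M (A B' - A' B) p) - A B p' q ≠ 0` (compare orders of vanishing at `a`).
[folklore] -/
theorem logDeriv_coeff_ne_zero {A B p q : ℂ[X]} (hA : A ≠ 0) (hB : B ≠ 0)
    (ha : (A.IsRoot a ∧ ¬ B.IsRoot a) ∨ (B.IsRoot a ∧ ¬ A.IsRoot a)) (hp : p ≠ 0) {M : ℕ}
    (hM : M ≠ 0) :
    p * (A * B * derivative q + (M : ℂ[X]) * (A * derivative B - derivative A * B) * p) -
      A * B * derivative p * q ≠ 0 := by
  -- Step 1: `n ≥ 1`, `R₁ ≠ 0`, `ord R₁ = n - 1`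
  have hR₀0 : A * B ≠ 0 := mul_ne_zero hA hB
  obtain ⟨hn1, hR₁0, hrmR₁⟩ : 1 ≤ rootMultiplicity a (A * B) ∧ A * derivative B - derivative A * B ≠ 0 ∧
      rootMultiplicity a (A * derivative B - derivative A * B) = rootMultiplicity a (A * B) - 1 := by
    rcases ha with ⟨hAa, hBa⟩ | ⟨hBa, hAa⟩
    · exact rootMultiplicity_logDeriv_num hA hB hAa hBa
    · obtain ⟨h1, h2, h3⟩ := rootMultiplicity_logDeriv_num hB hA hBa hAa
      have e0 : B * A = A * B := mul_comm _ _
      have e1 : B * derivative A - derivative B * A = -(A * derivative B - derivative A * B) := by ring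
      rw [e0] at h1 h3
      rw [e1] at h2 h3
      rw [rootMultiplicity_neg_eq] at h3
      exact ⟨h1, neg_ne_zero.1 h2, h3⟩
  set R₀ := A * B with hR₀
  set R₁ := A * derivative B - derivative A * B with hR₁
  set n := rootMultiplicity a R₀ with hn
  -- rewrite the expression
  have hS : p * (R₀ * derivative q + (M : ℂ[X]) * R₁ * p) - R₀ * derivative p * q =
      R₀ * (p * derivative q - derivative p * q) + (M : ℂ[X]) * R₁ * p ^ 2 := by ring
  rw [hS]
  -- Step 2: decompose `p`
  obtain ⟨P₁, hpP, hP₁⟩ := exists_eq_pow_rootMultiplicity_mul_and_not_dvd p hp a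
  set v := rootMultiplicity a p with hv
  -- the second term
  have hMne : ((M : ℂ[X])) ≠ 0 := by exact_mod_cast hM
  have hT₂0 : (M : ℂ[X]) * R₁ * p ^ 2 ≠ 0 := mul_ne_zero (mul_ne_zero hMne hR₁0) (pow_ne_zero _ hp)
  have hrmT₂ : rootMultiplicity a ((M : ℂ[X]) * R₁ * p ^ 2) = n - 1 + 2 * v := by
    rw [rootMultiplicity_mul hT₂0, rootMultiplicity_mul (mul_ne_zero hMne hR₁0), pow_two,
      rootMultiplicity_mul (mul_ne_zero hp hp), ← C_eq_natCast, rootMultiplicity_C, hrmR₁]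
    omega
  -- Step 3: the first term, by cases on `q`
  by_cases hq : q = 0
  · rw [hq, derivative_zero, mul_zero, mul_zero, sub_zero, mul_zero, zero_add]
    exact hT₂0
  obtain ⟨Q₁, hqQ, hQ₁⟩ := exists_eq_pow_rootMultiplicity_mul_and_not_dvd q hq a
  set u := rootMultiplicity a q with hu
  have hW : (X - C a) * (p * derivative q - derivative p * q) =
      (X - C a) ^ (u + v) * ((((u : ℂ[X])) - ((v : ℂ[X]))) * P₁ * Q₁ +
        (X - C a) * (P₁ * derivative Q₁ - derivative P₁ * Q₁)) := by
    conv_lhs => rw [hpP, hqQ]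
    exact X_sub_C_mul_wronskian a u v P₁ Q₁
  by_cases huv : u = v
  · -- equal orders: the first term is divisible by `(X - a)^{n + 2v}`
    have hW' : p * derivative q - derivative p * q =
        (X - C a) ^ (2 * v) * (P₁ * derivative Q₁ - derivative P₁ * Q₁) := by
      apply mul_left_cancel₀ (X_sub_C_ne_zero a)
      rw [hW, huv, sub_self, zero_mul, zero_mul, zero_add]
      ring
    have hdvd : (X - C a) ^ (n - 1 + 2 * v + 1) ∣ R₀ * (p * derivative q - derivative p * q) := by
      rw [hW', ← mul_assoc, show n - 1 + 2 * v + 1 = n + 2 * v by omega, pow_add]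
      exact (mul_dvd_mul (pow_rootMultiplicity_dvd R₀ a) dvd_rfl).mul_right _
    exact add_ne_zero_of_dvd_of_rootMultiplicity_eq (a := a) hdvd hT₂0 hrmT₂
  · -- different orders: the first term has order exactly `n + u + v - 1 ≠ n - 1 + 2v`
    have hW₁a : ¬ (X - C a) ∣ ((((u : ℂ[X])) - ((v : ℂ[X]))) * P₁ * Q₁ +
        (X - C a) * (P₁ * derivative Q₁ - derivative P₁ * Q₁)) := by
      intro h
      have h' : (X - C a) ∣ (((u : ℂ[X])) - ((v : ℂ[X]))) * P₁ * Q₁ := by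
        have := dvd_sub h (dvd_mul_right (X - C a) (P₁ * derivative Q₁ - derivative P₁ * Q₁))
        simpa using this
      have hprime : Prime (X - C a) := prime_X_sub_C a
      rcases hprime.dvd_or_dvd h' with h'' | h''
      · rcases hprime.dvd_or_dvd h'' with h3 | h3
        · rw [dvd_iff_isRoot, IsRoot] at h3
          simp only [eval_sub, eval_natCast] at h3
          exact huv (by exact_mod_cast (sub_eq_zero.1 h3))
        · exact hP₁ h3
      · exact hQ₁ h''
    have hWne : p * derivative q - derivative p * q ≠ 0 := by
      intro h0
      rw [h0, mul_zero] at hW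
      exact (mul_ne_zero (pow_ne_zero _ (X_sub_C_ne_zero a))
        fun h => hW₁a (by rw [h]; exact dvd_zero _)) hW.symm
    have huv1 : 1 ≤ u + v := by rcases Nat.eq_zero_or_pos u with hu0 | hu0 <;> omega
    have hrmW : rootMultiplicity a (p * derivative q - derivative p * q) = u + v - 1 := by
      have h1 : rootMultiplicity a ((X - C a) * (p * derivative q - derivative p * q)) = u + v := by
        rw [hW]; exact rootMultiplicity_pow_mul_of_not_dvd hW₁a
      rw [rootMultiplicity_mul (mul_ne_zero (X_sub_C_ne_zero a) hWne), rootMultiplicity_X_sub_C_self] at h1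
      omega
    have hT₁0 : R₀ * (p * derivative q - derivative p * q) ≠ 0 := mul_ne_zero hR₀0 hWne
    have hrmT₁ : rootMultiplicity a (R₀ * (p * derivative q - derivative p * q)) = n + (u + v - 1) := by
      rw [rootMultiplicity_mul hT₁0, hrmW]
    refine add_ne_zero_of_rootMultiplicity_ne (a := a) hT₁0 hT₂0 ?_
    rw [hrmT₁, hrmT₂]
    omega

end Orders

/-! ## Part B. No relation `P(z, L z) = 0` for a primitive `L` of `(A B' - A' B)/(A B)` -/

section Transcendence

/-- A two-variable polynomial evaluated at `(z, w)` as a finite sum over its `t`-coefficients.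
[folklore] -/
theorem evalPP_eq_sum (P : ℂ[X][X]) (z w : ℂ) {n : ℕ} (hn : P.natDegree < n) :
    (P.map (Polynomial.evalRingHom z)).eval w =
      ∑ j ∈ Finset.range n, (P.coeff j).eval z * w ^ j := by
  rw [Polynomial.eval_map, Polynomial.eval₂_eq_sum_range' _ hn]
  rfl

/-- Coefficients of `derivRel`. [folklore] -/
theorem coeff_derivRel (A B : ℂ[X]) (P : ℂ[X][X]) (j : ℕ) :
    (derivRel A B P).coeff j = if j < P.natDegree + 1 then
      A * B * derivative (P.coeff j) +
        ((j + 1 : ℕ) : ℂ[X]) * (A * derivative B - derivative A * B) * P.coeff (j + 1) else 0 := by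
  rw [derivRel, Polynomial.finsetSum_coeff]
  simp only [Polynomial.coeff_monomial, Finset.sum_ite_eq', Finset.mem_range]

/-- Pointwise evaluation of `derivRel`. [folklore] -/
theorem eval_derivRel (A B : ℂ[X]) (P : ℂ[X][X]) (z w : ℂ) :
    ((derivRel A B P).map (Polynomial.evalRingHom z)).eval w =
      ∑ j ∈ Finset.range (P.natDegree + 1), (A * B * derivative (P.coeff j) +
        ((j + 1 : ℕ) : ℂ[X]) * (A * derivative B - derivative A * B) * P.coeff (j + 1)).eval z * w ^ j := by
  rw [derivRel, Polynomial.map_sum, Polynomial.eval_finsetSum]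
  simp only [Polynomial.map_monomial, Polynomial.eval_monomial, Polynomial.coe_evalRingHom]

/-- The reindexing `Σ_{j ≤ N} (j+1) c_{j+1} w^j = Σ_{j ≤ N} j c_j w^{j-1}` when `c_{N+1} = 0`.
[folklore] -/
theorem sum_succ_shift {N : ℕ} (c : ℕ → ℂ) (hc : c (N + 1) = 0) (w : ℂ) :
    ∑ j ∈ Finset.range (N + 1), ((j + 1 : ℕ) : ℂ) * c (j + 1) * w ^ j =
      ∑ j ∈ Finset.range (N + 1), (j : ℂ) * c j * w ^ (j - 1) := by
  rw [Finset.sum_range_succ, hc, mul_zero, zero_mul, add_zero, Finset.sum_range_succ']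
  simp

/-- **A primitive of the logarithmic derivative of a non-constant rational function is
transcendental over `ℂ(z)`.**  `A, B ∈ ℂ[z]` nonzero with a point that is a root of exactly one of
them; `L` analytic at `z₀` with `L' = (A B' - A' B)/(A B)` near `z₀`, `(A B)(z₀) ≠ 0`.  Then no
nonzero `P ∈ ℂ[s][t]` satisfies `P(z, L z) = 0` near `z₀` (in germ form:
`germEval₂ z₀ (germ L) P ≠ 0`). [folklore] -/
theorem not_algebraic_of_hasDerivAt_logDeriv {z₀ : ℂ} {A B : ℂ[X]} (hA : A ≠ 0) (hB : B ≠ 0)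
    {a : ℂ} (ha : (A.IsRoot a ∧ ¬ B.IsRoot a) ∨ (B.IsRoot a ∧ ¬ A.IsRoot a))
    {L : ℂ → ℂ} (hLan : AnalyticAt ℂ L z₀)
    (hL : ∀ᶠ z in 𝓝 z₀,
      HasDerivAt L ((A * derivative B - derivative A * B).eval z / (A * B).eval z) z)
    (h0 : (A * B).eval z₀ ≠ 0) {P : ℂ[X][X]} (hP0 : P ≠ 0)
    (hP : germEval₂ z₀ (AGerm.mk z₀ hLan) P = 0) : False := by
  -- a relation of minimal `t`-degree
  obtain ⟨P, hP0, hP, hmin⟩ :=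
    exists_minDegree_of_exists (germEval₂ z₀ (AGerm.mk z₀ hLan)) ⟨P, hP0, hP⟩
  set M := P.natDegree with hM
  set R₀ : ℂ[X] := A * B with hR₀
  set R₁ : ℂ[X] := A * derivative B - derivative A * B with hR₁
  -- `M ≥ 1`
  have hM1 : M ≠ 0 := by
    intro hM0
    have hPC : P = Polynomial.C (P.coeff 0) := Polynomial.eq_C_of_natDegree_eq_zero hM0
    rw [hPC, germEval₂_C] at hP
    have h00 : P.coeff 0 = 0 := by
      by_contra hne
      exact aeval_zGerm_ne_zero z₀ hne hP
    exact hP0 (by rw [hPC, h00, map_zero])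
  have hlead : P.coeff M ≠ 0 := by
    rw [hM]
    exact Polynomial.leadingCoeff_ne_zero.2 hP0
  -- the function identity and its derivative
  have hF : (fun z => (P.map (Polynomial.evalRingHom z)).eval (L z)) =ᶠ[𝓝 z₀] 0 :=
    (germEval₂_mk_eq_zero_iff hLan P).1 hP
  have hR₀ev : ∀ᶠ z in 𝓝 z₀, R₀.eval z ≠ 0 :=
    (Polynomial.differentiable R₀).continuous.continuousAt.eventually_ne h0
  have hcoeff : P.coeff (M + 1) = 0 := by
    rw [hM]; exact Polynomial.coeff_natDegree_succ_eq_zero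
  have hFF : ∀ᶠ z in 𝓝 z₀, (fun y => (P.map (Polynomial.evalRingHom y)).eval (L y)) =ᶠ[𝓝 z] 0 :=
    eventually_eventually_nhds.2 hF
  have hG : ∀ᶠ z in 𝓝 z₀, ((derivRel A B P).map (Polynomial.evalRingHom z)).eval (L z) = 0 := by
    filter_upwards [hL, hR₀ev, hFF] with z hLz hR₀z hFz
    set g : ℂ := R₁.eval z / R₀.eval z with hg
    -- derivative of `F` at `z`
    have e : (fun y => (P.map (Polynomial.evalRingHom y)).eval (L y)) =
        fun y => ∑ j ∈ Finset.range (M + 1), (P.coeff j).eval y * L y ^ j :=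
      funext fun y => evalPP_eq_sum P y (L y) (Nat.lt_succ_self _)
    have hderF : HasDerivAt (fun y => (P.map (Polynomial.evalRingHom y)).eval (L y))
        (∑ j ∈ Finset.range (M + 1), ((derivative (P.coeff j)).eval z * L z ^ j +
          (P.coeff j).eval z * ((j : ℂ) * L z ^ (j - 1) * g))) z := by
      rw [e]
      exact HasDerivAt.fun_sum fun j _ => (Polynomial.hasDerivAt (P.coeff j) z).fun_mul (hLz.fun_pow j)
    have hzero : ∑ j ∈ Finset.range (M + 1), ((derivative (P.coeff j)).eval z * L z ^ j +
          (P.coeff j).eval z * ((j : ℂ) * L z ^ (j - 1) * g)) = 0 :=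
      hderF.unique ((hasDerivAt_const z (0 : ℂ)).congr_of_eventuallyEq hFz)
    -- `R₀(z) · F'(z)` is the evaluation of `derivRel`
    have hshift := sum_succ_shift (N := M) (fun j => (P.coeff j).eval z) (by simp [hcoeff]) (L z)
    calc ((derivRel A B P).map (Polynomial.evalRingHom z)).eval (L z)
        = ∑ j ∈ Finset.range (M + 1), (R₀.eval z * ((derivative (P.coeff j)).eval z * L z ^ j)) +
            R₁.eval z * ∑ j ∈ Finset.range (M + 1),
              ((j + 1 : ℕ) : ℂ) * (P.coeff (j + 1)).eval z * L z ^ j := by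
          rw [eval_derivRel, Finset.mul_sum, ← Finset.sum_add_distrib]
          refine Finset.sum_congr rfl fun j _ => ?_
          simp only [Polynomial.eval_add, Polynomial.eval_mul, Polynomial.eval_natCast, hR₀, hR₁]
          ring
      _ = R₀.eval z * ∑ j ∈ Finset.range (M + 1), ((derivative (P.coeff j)).eval z * L z ^ j +
            (P.coeff j).eval z * ((j : ℂ) * L z ^ (j - 1) * g)) := by
          rw [hshift, Finset.mul_sum, Finset.mul_sum, ← Finset.sum_add_distrib]
          refine Finset.sum_congr rfl fun j _ => ?_
          rw [hg]
          field_simp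
      _ = 0 := by rw [hzero, mul_zero]
  have hPt : germEval₂ z₀ (AGerm.mk z₀ hLan) (derivRel A B P) = 0 :=
    (germEval₂_mk_eq_zero_iff hLan _).2 hG
  -- the combination of lower degree
  set Q : ℂ[X][X] := Polynomial.C (P.coeff M) * derivRel A B P -
    Polynomial.C (R₀ * derivative (P.coeff M)) * P with hQ
  have hQev : germEval₂ z₀ (AGerm.mk z₀ hLan) Q = 0 := by
    rw [hQ, map_sub, map_mul, map_mul, hPt, hP, mul_zero, mul_zero, sub_zero]
  have hcoefQ : ∀ j, M ≤ j → Q.coeff j = 0 := by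
    intro j hj
    rw [hQ, Polynomial.coeff_sub, Polynomial.coeff_C_mul, Polynomial.coeff_C_mul, coeff_derivRel]
    rcases eq_or_lt_of_le hj with h | h
    · rw [← h, if_pos (by omega), hcoeff, mul_zero, add_zero]
      ring
    · rw [if_neg (by omega), Polynomial.coeff_eq_zero_of_natDegree_lt (by omega : P.natDegree < j)]
      ring
  have hQ0 : Q = 0 := by
    by_contra hne
    have hdeg : Q.natDegree < M := by
      rw [Polynomial.natDegree_lt_iff_degree_lt hne, Polynomial.degree_lt_iff_coeff_zero]
      exact hcoefQ
    exact absurd (hmin Q hne hQev) (not_le.2 hdeg)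
  -- the `t^{M-1}` coefficient
  have hcM1 : Q.coeff (M - 1) = P.coeff M * (R₀ * derivative (P.coeff (M - 1)) +
      (M : ℂ[X]) * R₁ * P.coeff M) - R₀ * derivative (P.coeff M) * P.coeff (M - 1) := by
    rw [hQ, Polynomial.coeff_sub, Polynomial.coeff_C_mul, Polynomial.coeff_C_mul, coeff_derivRel,
      if_pos (by omega), Nat.sub_add_cancel (Nat.one_le_iff_ne_zero.2 hM1)]
  rw [hQ0, Polynomial.coeff_zero] at hcM1
  exact logDeriv_coeff_ne_zero hA hB ha hlead hM1 hcM1.symm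

end Transcendence

end Summit.Schanuel.Schanuel.Theorems
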